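import Summits.BirchSwinnertonDyer.BirchSwinnertonDyer.Theorems.ErratumRoadFiveNonSurjCornerHybridLabelsOnlyX11aByName
import HarnessLib

/-!
# Route `ErratumRoadFive` (rung K2), crux `NonSurjCorner` (item stmt-BirchSwinnertonDyer-19065), line `Lines/hybrid.lean`:
# THE `Ш_an`-CUT OF THE μ-SLOT — analytic `μ = 0` at the leaf twins (item 19948) is load-bearing ONLY at the DEEP corner pairs
# (`0 < ord_p #Ш(E)_an`), exactly like the Kolyvagin certificates (slot 1, g14's cut) — CORE COMPOSITION (sequel: glue #20)
# (cell `bsd-stepL`, seat `bsd-stepL-corner-p1` g18; `--supports stmt-BirchSwinnertonDyer-19065 --as helper`)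

WHY THIS FILE. In every hybrid glue since g16 (`X11b.erratumRoadFive_nonSurjCorner_of_kolyZShaAn_of_kolyJMax_of_multiUpper_of_lowerLeafTwinDeep_of_
twinMultDivisibility[_of_casselsTate]`, files `…HybridTwinLowerSupply[ChaKernel]`) the p-part at a corner pair `(E, p)` is assembled from FOUR halves:
(U_E) the Euler half of `E` ⟸ Kolyvagin ∕ Shimura over the Heegner field `K` + the twin's LOWER half (slot 4, `X11aLowerHalf` at the leaf twin `E^{d_K}`);
(L_E) the converse half of `E`, which is TRIVIAL when `ord_p #Ш(E)_an ≤ 0` and otherwise ⟸ Kolyvagin certificates over `K` (slot 1) + the twin's UPPER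
half — and the twin's upper half is the ONLY consumer of Kato's divisibility at the twin (`MultDivisibilityAt`, from Kato 12.4 + §17.13 V′∕VI′∕XI′ made
integral by the analytic `μ = 0` of slot 2 = item 19948, `X11b.multDivisibilityAt_of_katoFacts_of_muAn_contra_of_mazur`). Reading the proof: the binder
`hdiv` (Kato divisibility at EVERY non-surjective X11a leaf twin) is used once, inside the branch `0 < ord_p s`, at the Friedberg–Hoffstein twin model
`Wd = Cd • E^{(d_K)}` of THAT deep pair. So slot 2 can be cut exactly as slot 1 was (g14): **analytic `μ = 0` is needed only at the leaf twins of the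
DEEP corner pairs** — those `(E, p)` with `#Ш(E)_an = s`, `0 < ord_p s`. Census (lane B corner5-p2 CENSUS-G9, `N ≤ 4·10¹⁰`): ONE deep pair at `p = 5`
among 2 430 (`J9t-73o125d-14`, `N = 5 112 322 880`, 5S4, `#Ш_an = 25`), NONE at `p = 7` among 57; at every other corner pair item 19948 is IDLE.
* §1 `X11b.erratumRoadFive_nonSurjCorner_of_kolyZShaAn_of_kolyJMax_of_multiUpper_of_lowerLeafTwinDeep_of_twinMultDivisibilityDeep_of_casselsTate` —
  `…TwinLowerSupplyChaKernel` §2 with `hdiv` asked ONLY at the Friedberg–Hoffstein twin models of the deep corner pairs (token for token otherwise);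
* the glue (#20), the projection 19948 ⟹ cut, and the by-items glue in the deep shape are in the sequel `…HybridTwinMuAnDeep` (400-line rule).

HONEST FRAMING: ONE THEOREM (no definition, no named fact, no `sorry`); CONDITIONAL on every displayed binder; no stub is proved — one open input
(19948) is shown IDLE off the deep pairs; 19065 NOT closed by this file; nothing about any curve's BSD; BSD is not advanced; T7.
References (locators only): [cite: Kato2004Asterisque, Thm. 12.4, §17.13 (pp. 279–280)] [cite: GreenbergLNM1716, §1 Conj. 1.11 (p. 61)]
[cite: Cha2005, Thm. 21 and Rmk. 25] [cite: Jetchev2008, Thm. 1.1, Cor. 1.5] [cite: PastenShimura2024, Prop. 6.13, Lemma 6.18]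
[cite: GrossLMS1991, §3 Prop. 3.7 (2)] [cite: Mazur1978, Cor. 4.1] [cite: Miller2011LMS, Def. 1.1].
-/

set_option autoImplicit false
set_option linter.dupNamespace false -- `Summit.BirchSwinnertonDyer.BirchSwinnertonDyer` (summit = problem), tree-wide

noncomputable section

open scoped Classical NumberField MatrixGroups ModularForm

/-! ### §1 The hybrid cut with Kato's divisibility asked only at the twins of the DEEP corner pairs -/

namespace Summit.BirchSwinnertonDyer.Rank1Residual.X11b

open CongruenceSubgroup WeierstrassCurve NumberField IsDedekindDomain Field
  Literature.NumberTheory.EllipticCurves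
  Literature.NumberTheory.EllipticCurves.ModularForms
  Literature.NumberTheory.EllipticCurves.Rank1Residual
  Literature.NumberTheory.EllipticCurves.Rank1Residual.Typed
  Literature.NumberTheory.EllipticCurves.Wuthrich2014
  Literature.NumberTheory.EllipticCurves.SteinWuthrich2013
  Literature.NumberTheory.EllipticCurves.GreenbergVatsal2000
  Literature.NumberTheory.EllipticCurves.EmertonPollackWeston2006
  Literature.NumberTheory.QuadraticFields.Quadratic
  Literature.NumberTheory.GaloisRepresentations
  Summit.BirchSwinnertonDyer.Rank1Residual
  Summit.BirchSwinnertonDyer.Rank1Residual.RankZeroHeightFree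
  Summit.BirchSwinnertonDyer.Rank1Residual.X11b.Three.Koly
  Summit.BirchSwinnertonDyer.BirchSwinnertonDyer.Theorems

/-- **`…TwinLowerSupplyChaKernel` §2 with Kato's divisibility at the twin asked ONLY at the DEEP corner pairs.** Same statement and proof as
`erratumRoadFive_nonSurjCorner_of_kolyZShaAn_of_kolyJMax_of_multiUpper_of_lowerLeafTwinDeep_of_twinMultDivisibility_of_casselsTate` (g17, p630826)
except that the binder `hdiv` (the typed Kato divisibility `MultDivisibilityAt Wd p` at every non-surjective X11a leaf twin) is replaced by `hdivD`:
the same divisibility asked only at the Friedberg–Hoffstein twin models `Wd = Cd • E^{(d_K)}` (`K` imaginary quadratic, Heegner for `N_E`,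
`L(E^{(d_K)}, 1) ≠ 0`) of the corner pairs `(E, p)` with `#Ш(E)_an = s`, `0 < ord_p s`. Reason: `hdiv` feeds only the twin's Euler half
(`missingUpperBoundAt_of_classX11a_of_multDivisibilityAt`), which is consumed only by the converse half of `E`
(`missingLowerBoundAt_of_classX11b_of_indexLowerBoundNoSurj_of_upperTwist`), which is invoked only in the branch `0 < ord_p s` — the converse half is
trivial otherwise (`missingLowerBoundAt_of_shaAn_nonpos`). Upper half by carrier profile and the deep ∕ shallow certificate split VERBATIM.
CONDITIONAL on every binder; does NOT close 19065; nothing booked; T7.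
[cite: Miller2011LMS, Def. 1.1] [cite: Cha2005, Thm. 21 and Rmk. 25 (pp. 173–175)] [cite: Kato2004Asterisque, Thm. 12.4] -/
theorem erratumRoadFive_nonSurjCorner_of_kolyZShaAn_of_kolyJMax_of_multiUpper_of_lowerLeafTwinDeep_of_twinMultDivisibilityDeep_of_casselsTate
    (hGZ : ∀ (N : ℕ) [NeZero N] (W : WeierstrassCurve ℚ) (K : Type) [Field K] [NumberField K],
      gross_zagier N W K)
    (hKo : ∀ (N : ℕ) [NeZero N] (W : WeierstrassCurve ℚ) (K : Type) [Field K] [NumberField K],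
      kolyvagin N W K)
    (hWu : sha_dvd_analyticSha)
    (hGZK : rank_eq_analyticRank_of_analyticRank_le_one) (hmod : hasEntireLFunction_rat)
    (hnf : exists_isNewformOf) (hpar : nonempty_modularParametrizationData)
    (hFHs : friedbergHoffstein_exists_heegnerField_split_twist_ne_zero)
    (hMaz : mazur_not_dvd_maninConstant_of_odd)
    (hrec : ∀ (N : ℕ) [NeZero N] (W : WeierstrassCurve ℚ) (K : Type) [Field K] [NumberField K],
      heegnerPointOfConductor_one_galoisConj N W K)
    (hD36 : ∀ (N : ℕ) [NeZero N] (W : WeierstrassCurve ℚ) (K : Type) [Field K] [NumberField K],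
      phi_heegnerTau_mem_singularModuliField N W K)
    (hJs : thm61_splitMultiplicative) (hJn : thm61_nonsplitMultiplicative)
    (hGS : ∀ (W : WeierstrassCurve ℚ) [W.IsElliptic] [W.IsGloballyMinimal] (p : ℕ) [Fact p.Prime],
      greenberg_stevens (W := W) (p := p))
    (hChaL : Cha2005.rmk25_pow_dvd_card_sha_primary_of_certificate)
    (hCT : ∀ (K : Type) [Field K] [NumberField K], casselsTate_levelInputs K)
    (h372 : GrossLMS1991.prop37_2_frobeniusCongruence)
    (h₄ℓ : ∀ (Wd : WeierstrassCurve ℚ) [Wd.IsElliptic] [Wd.IsGloballyMinimal] (p : ℕ) [Fact p.Prime],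
      ClassX11a Wd p → ¬ Surj Wd p → (p = 5 ∨ p = 7) → p ∣ padicValInt p Wd.minimalDiscriminantInt →
      ¬ X11a.ShaAnUnit Wd p → Typed.MissingLowerBoundAt Wd p)
    (hZan : ∀ (W : WeierstrassCurve ℚ) [W.IsElliptic] [W.IsGloballyMinimal] (p : ℕ) [Fact p.Prime]
      (N : ℕ) [NeZero N] (K : Type) [Field K] [NumberField K]
      (Dt : ModularParametrizationData W N) (β : ℤ) (ι : K →+* ℂ),
      ClassX11b W p → ¬ Surj W p → (p = 5 ∨ p = 7) → p ∣ padicValInt p W.minimalDiscriminantInt →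
      ¬ Ram W p → (∃ s : ℚ, shaAn W = (s : ℂ) ∧ 0 < padicValRat p s) →
      W.conductorNorm ℤ = N → IsImaginaryQuadratic K →
      4 < (NumberField.discr K).natAbs → SatisfiesHeegnerHypothesis N K →
      SatisfiesHeegnerHypothesis p K → (4 * (N : ℤ)) ∣ β ^ 2 - NumberField.discr K → ¬ (p : ℤ) ∣ Dt.c →
      (∃ (d₁ : KolyvaginHeegnerData Dt β ι 1) (y : (W.baseChange K).toAffine.Point),
        WeierstrassCurve.Affine.Point.map (W' := W) (algebraMap K (ringClassField K ι 1)).toRatAlgHom y =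
          d₁.derivedPoint ∧
        ∃ Q : (W.baseChange K).toAffine.Point, ((p ^ (padicValNat p W.tamagawaProduct + 1) : ℕ) : ℤ) • Q = y) →
      ∃ M : ℕ, M ≤ padicValNat p W.tamagawaProduct ∧ CertificateAt Dt β ι p M)
    (hJmax : ∀ (W : WeierstrassCurve ℚ) [W.IsElliptic] [W.IsGloballyMinimal] [NeZero (W.conductorNorm ℤ)]
      (p : ℕ) [Fact p.Prime] (K : Type) [Field K] [NumberField K]
      (Dt : ModularParametrizationData W (W.conductorNorm ℤ)) (β : ℤ) (ι : K →+* ℂ),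
      p ∣ W.tamagawaProduct →
      ClassX11b W p → ¬ Surj W p → (p = 5 ∨ p = 7) → p ∣ padicValInt p W.minimalDiscriminantInt →
      ¬ Ram W p → IsImaginaryQuadratic K → 4 < (NumberField.discr K).natAbs →
      SatisfiesHeegnerHypothesis (W.conductorNorm ℤ) K → SatisfiesHeegnerHypothesis p K →
      (4 * (W.conductorNorm ℤ : ℤ)) ∣ β ^ 2 - NumberField.discr K → ¬ (p : ℤ) ∣ Dt.c →
      ∀ (v : HeightOneSpectrum (𝓞 ℚ)) (s : ℕ), s ≤ padicValNat p (W.tamagawaNumberAt v) →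
        ∀ (n : ℕ) (d : KolyvaginHeegnerData Dt β ι n), Squarefree n →
          (∀ ℓ ∈ n.primeFactors, Zhang2014.IsKolyvaginPrime (W.conductorNorm ℤ) W K p ℓ ∧
            s ≤ Zhang2014.kolyvaginIndex W p ℓ) → PDiv d p s)
    (hUmulti : ∀ (W : WeierstrassCurve ℚ) [W.IsElliptic] [W.IsGloballyMinimal] (p : ℕ) [Fact p.Prime],
      ClassX11b W p → ¬ Surj W p → (p = 5 ∨ p = 7) → p ∣ padicValInt p W.minimalDiscriminantInt →
      ¬ Ram W p → p ∣ W.tamagawaProduct →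
      (∀ v : HeightOneSpectrum (𝓞 ℚ), padicValNat p (W.tamagawaNumberAt v) < padicValNat p W.tamagawaProduct) →
      Typed.MissingUpperBoundAt W p)
    -- Kato's typed divisibility ONLY at the Friedberg–Hoffstein twin models of the DEEP corner pairs
    (hdivD : ∀ (W : WeierstrassCurve ℚ) [W.IsElliptic] [W.IsGloballyMinimal] (p : ℕ) [Fact p.Prime],
      ClassX11b W p → ¬ Surj W p → (p = 5 ∨ p = 7) → p ∣ padicValInt p W.minimalDiscriminantInt →
      ¬ Ram W p → (∃ s : ℚ, shaAn W = (s : ℂ) ∧ 0 < padicValRat p s) →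
      ∀ (K : Type) [Field K] [NumberField K] (Wd : WeierstrassCurve ℚ) [Wd.IsElliptic] [Wd.IsGloballyMinimal]
        (Cd : VariableChange ℚ),
        IsImaginaryQuadratic K → SatisfiesHeegnerHypothesis (W.conductorNorm ℤ) K →
        (W.quadraticTwist (NumberField.discr K : ℚ)).entireLFunction 1 ≠ 0 →
        Cd • W.quadraticTwist (NumberField.discr K : ℚ) = Wd →
        ClassX11a Wd p → ¬ Surj Wd p → p ∣ padicValInt p Wd.minimalDiscriminantInt →
        MultDivisibilityAt Wd p) :
    Summit.BirchSwinnertonDyer.BirchSwinnertonDyer.Theses.ErratumRoadFive.NonSurjCorner := by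
  intro W _ _ p _ hX hns h57 hv hnr
  have hp5 : 5 ≤ p := by rcases h57 with h | h <;> omega
  -- the X11a lower half at every NON-SURJECTIVE X11a LEAF twin at `p`: trivial at a unit `#Ш_an`, `h₄ℓ` otherwise
  have h₄ : ∀ (Wd : WeierstrassCurve ℚ) [Wd.IsElliptic] [Wd.IsGloballyMinimal], ClassX11a Wd p → ¬ Surj Wd p →
      p ∣ padicValInt p Wd.minimalDiscriminantInt → Typed.MissingLowerBoundAt Wd p := fun Wd _ _ hXa hnsd hvd ↦ by
    by_cases hu : X11a.ShaAnUnit Wd p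
    · obtain ⟨q, hq, hvq⟩ := hu
      exact ⟨q, hq, by rw [hvq]; exact_mod_cast Nat.zero_le _⟩
    · exact h₄ℓ Wd p hXa hnsd h57 hvd hu
  haveI : NeZero (W.conductorNorm ℤ) := ⟨(W.conductorNorm_pos_holds).ne'⟩
  -- the UPPER half, by CARRIER PROFILE (as in p579499 ∕ p630826) — no Kato input here
  have hupper : Typed.MissingUpperBoundAt W p := by
    by_cases hcase : ¬ p ∣ W.tamagawaProduct ∨
        ∃ v : HeightOneSpectrum (𝓞 ℚ), padicValNat p W.tamagawaProduct ≤ padicValNat p (W.tamagawaNumberAt v)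
    · refine missingUpperBoundAt_corner_of_jetchevDivisibility_of_twinLeafLower_of_casselsTate' hGZ hKo hGZK hmod hnf hFHs hMaz
        hrec hD36 hCT h372 W p hX hns h57 hv hnr (fun Wd _ _ hXa hnsd hvd ↦ h₄ Wd hXa hnsd hvd) ?_
      intro _ K _ _ Dt β ι hK hdisc hHN hHp hβ hc s hs n d hn hℓ
      rcases hcase with htam | ⟨v, hvt⟩
      · exact Summit.BirchSwinnertonDyer.BirchSwinnertonDyer.Theorems.nonSurjCornerKolyJ_of_not_dvd_tamagawa W p K
          Dt β ι htam hX hns h57 hv hnr hK hdisc hHN hHp hβ hc s hs n d hn hℓ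
      · by_cases htam : p ∣ W.tamagawaProduct
        · exact hJmax W p K Dt β ι htam hX hns h57 hv hnr hK hdisc hHN hHp hβ hc v s (hs.trans hvt) n d hn hℓ
        · exact Summit.BirchSwinnertonDyer.BirchSwinnertonDyer.Theorems.nonSurjCornerKolyJ_of_not_dvd_tamagawa W p K
            Dt β ι htam hX hns h57 hv hnr hK hdisc hHN hHp hβ hc s hs n d hn hℓ
    · push Not at hcase
      exact hUmulti W p hX hns h57 hv hnr hcase.1 hcase.2
  -- the LOWER half: trivial when `ord_p #Ш(E)_an ≤ 0`; otherwise Zₚᶜ at the Hoffstein–Luo frame (deep or shallow) + Kato at THIS pair's twin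
  obtain ⟨s, hs, hsv⟩ := hupper
  by_cases hs0 : padicValRat p s ≤ 0
  · exact Typed.missingPPartAt_of_lower_of_upper W p (missingLowerBoundAt_of_shaAn_nonpos W p hs hs0) ⟨s, hs, hsv⟩
  have hspos : ∃ s : ℚ, shaAn W = (s : ℂ) ∧ 0 < padicValRat p s := ⟨s, hs, lt_of_not_ge hs0⟩
  refine Typed.missingPPartAt_of_lower_of_upper W p ?_ ⟨s, hs, hsv⟩
  refine missingLowerBoundAt_of_classX11b_of_indexLowerBoundNoSurj_of_upperTwist hGZ hKo hWu hGZK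
    hmod hnf hFHs hMaz W p hX hp5
    (fun N _ K _ _ Dt H ι P hN hK hdisc hHN hHp hLt hP hc hPinf ↦
      indexLowerBoundAt_corner_of_certificates hGZ hKo hmod hrec hD36 hChaL W p N K Dt H ι P hX hp5 hN
        hK hdisc hHN hLt hP hPinf (by
          by_cases hdeep : ∃ (d₁ : KolyvaginHeegnerData Dt H.β ι 1) (y : (W.baseChange K).toAffine.Point),
              WeierstrassCurve.Affine.Point.map (W' := W) (algebraMap K (ringClassField K ι 1)).toRatAlgHom y =
                d₁.derivedPoint ∧
              ∃ Q : (W.baseChange K).toAffine.Point, ((p ^ (padicValNat p W.tamagawaProduct + 1) : ℕ) : ℤ) • Q = y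
          · exact hZan W p N K Dt H.β ι hX hns h57 hv hnr hspos hN hK hdisc hHN hHp H.dvd_sq_sub hc hdeep
          · push Not at hdeep
            exact nonSurjCornerKolyZ_of_bottom_not_pow_divisible' W p N K Dt H.β ι hX hns h57 hv hnr hN hK hdisc hHN
              hHp H.dvd_sq_sub hc (fun d₁ y hy hQ => by obtain ⟨Q, hQ⟩ := hQ; exact hdeep d₁ y hy Q hQ)))
    ?_
  -- the Euler-system half of THIS pair's Friedberg–Hoffstein twin, from the typed divisibility asked at the deep pair only
  intro K _ _ Wd _ _ Cd hK hHN hLt hWd hnsd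
  have hD0 : (NumberField.discr K : ℚ) ≠ 0 := by exact_mod_cast NumberField.discr_ne_zero K
  haveI : (W.quadraticTwist (NumberField.discr K : ℚ)).IsElliptic := W.isElliptic_quadraticTwist hD0
  have hrd : Wd.analyticRank = 0 := by
    rw [← hWd, analyticRank_smul]
    exact analyticRank_eq_zero_of_entireLFunction_one_ne_zero _ hLt
  have hXa : ClassX11a Wd p := classX11a_twist_of_not_ram W p hX hnr K hK hHN Cd hWd hrd
  have hpN : p ∣ W.conductorNorm ℤ := dvd_conductorNorm_of_mult hX.2.2.1
  have hsq := isSquare_discr_padic_of_heegner K hK hHN p hpN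
  have hvd : p ∣ padicValInt p Wd.minimalDiscriminantInt := by
    rw [padicValInt_minimalDiscriminantInt_twist_eq W p hD0 hsq Cd hWd]
    exact hv
  exact missingUpperBoundAt_of_classX11a_of_multDivisibilityAt hJs hJn hGZK hmod hpar Wd p (hGS Wd p) hXa
    (hdivD W p hX hns h57 hv hnr hspos K Wd Cd hK hHN hLt hWd hXa hnsd hvd)

end Summit.BirchSwinnertonDyer.Rank1Residual.X11b

end
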